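import Mathlib
import HarnessLib.Audit
import Summits.PneNP.PneNP.Theorems.PstarSwitchSplitTools
import Summits.PneNP.PneNP.Theorems.PstarTerminalPeelableTwelve

/-!
# XOR-disconnected terminal cores coupled through ONE switch literal: the gated side is itself a terminal core (ROUND-24, O1; all core sizes; memo g25 §41–§42)

FRONTIER range-avoidance ladder, rung F-N3, ROUND 24 (cell `pnp-ideate`, prover-2 memo `g25/O1-XORSPLIT-g25.md` §41–§42; typed targets
`PstarCoreBoundTargets.TerminalFive` / `TerminalPeelable` (p646951); restricted-model proof complexity — nothing here bears on `P` versus `NP`).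

`PstarAdditiveSplit.false_of_additive_split` excludes a split `K = A ∪ B` of a terminal core along a variable set `P` (all variables of `A` in
`P`, none of `B`) when NO reader monomial straddles `P`.  This file treats the simplest coupling: every straddling monomial has its variable
outside `P` equal to ONE variable `q` (a SWITCH literal: any number of gates `(p, q)` with `p ∈ P`; e.g. a single cross gadget / gate).

* **`exists_terminal_side`** (all `k`, unconditional).  Then the side `A` is itself a TERMINAL CORE for an explicit pair of readers supported on `P`:
  the `P`-parts of `w₁, w₂` plus, for one value `κ` of the switch, the set of `P`-literals gated to `q` an odd number of times (`PstarSwitchSplitTools.litSet`).  Proof: the readers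
  split as `wᵢ = Fᵢ^{z_q}(z|P) ⊕ Qᵢ(z|Pᶜ)` with `Fᵢ^κ = Fᵢ ⊕ κ·parity(litSet)` (`PstarSwitchSplitTools.gval_split_switch`); gluing `Sol(A) × Sol(B)` and Lemma S
  (`PstarAdditiveSplit.gval_ne_of_ne_on_sol`) over `A` pin the `Pᶜ`-part on each switch class met by an (M0)-witness of an `A`-member; if both
  classes are met, Lemma S over `B` (with the switch literal added linearly) contradicts the (M0)-witness of a `B`-member; so all witnesses of
  `A`-members lie in one class `κ`, where they are exactly the (M0)-witnesses of `(A; F^κ)`.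
* **`card_le_ten_of_switch`** (inside the core-bound induction: proper terminal sub-cores have at most five members): if in addition every
  straddling monomial has its `P`-variable equal to one variable `p` (so: a single cross monomial `(p, q)`, possibly repeated in both readers),
  both sides are terminal cores, hence `#K ≤ 10`; **`no_centre_of_switch`**: such a core carries NO centre (a leafless set of non-chords forces
  `#K ≥ 12`, `PstarTerminalPeelableTwelve.twelve_le_two_mul_card_sharedSlots`) — the census of centre structures may discard it.
-/

set_option linter.dupNamespace false -- `Summit.PneNP.PneNP.…`: summit = sub-problem name (D-0017 single-conjunct layout)

open Finset Literature.Computability.Complexity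
open scoped symmDiff
open Summit.PneNP.PneNP.Theorems.PstarFibrePolys (bit bit_injective bit_xor bit_and)
open Summit.PneNP.PneNP.Theorems.PstarPDT (parity parity_singleton)
open Summit.PneNP.PneNP.Theorems.PstarGraphQuadGapOne (bit_parity)
open Summit.PneNP.PneNP.Theorems.PstarTyped (Typed)
open Summit.PneNP.PneNP.Theorems.PstarSALevel (varSet bdry BoundaryExpanding SimpleOverlap)
open Summit.PneNP.PneNP.Theorems.PstarSAClosure (degIn mem_bdry_iff)
open Summit.PneNP.PneNP.Theorems.PstarXCore (xverts)
open Summit.PneNP.PneNP.Theorems.PstarGapPeeling (eval_pure)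
open Summit.PneNP.PneNP.Theorems.PstarGapOneAll (gval gval_empty)
open Summit.PneNP.PneNP.Theorems.PstarGConstraint (bit_gval)
open Summit.PneNP.PneNP.Theorems.PstarGSystemFreeVar (gval_symmDiff)
open Summit.PneNP.PneNP.Theorems.PstarCoreBound (XorClosed)
open Summit.PneNP.PneNP.Theorems.PstarChordRepair (IsChord)
open Summit.PneNP.PneNP.Theorems.PstarCoreBoundTargets (Terminal)
open Summit.PneNP.PneNP.Theorems.PstarSharingBound (two_mul_card_sharedSlots_le)
open Summit.PneNP.PneNP.Theorems.PstarChordBridgeTools (xpdeg)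
open Summit.PneNP.PneNP.Theorems.PstarChordReadFibre (symmDiff_subset_union')
open Summit.PneNP.PneNP.Theorems.PstarTerminalPeelableTwelve (twelve_le_two_mul_card_sharedSlots)
open Summit.PneNP.PneNP.Theorems.PstarAdditiveSplit (gval_ne_of_ne_on_sol eval_congr gval_congr pin_of_three)
open Summit.PneNP.PneNP.Theorems.PstarSwitchSplitTools

namespace Summit.PneNP.PneNP.Theorems.PstarSwitchSplit

variable {n m : ℕ} {I : LocalMap 4 n m} {r : ℕ} {y : Fin m → Bool} {K : Finset (Fin m)} {w₁ w₂ : Finset (Fin n) × Finset (Fin m) × Bool}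

/-! ## The theorem -/

/-- **THE GATED SIDE OF A SWITCH-COUPLED SPLIT IS A TERMINAL CORE** (all core sizes, unconditional).  Let `(K; w₁, w₂)` be a terminal core of a pure
typed `(r,3/2)`-expanding instance with simple overlaps, `K = A ∪ B` with `A, B` non-empty, `P` a set of variables containing every variable of
every member of `A` and none of any member of `B`, and `q ∉ P` a variable such that every monomial of `w₁, w₂` straddling `P` has its outside
variable equal to `q`.  Then `A` is a terminal core for two readers supported on `P` whose monomials are the `P`-internal monomials of `w₁`, `w₂`
(namely the `P`-parts of the readers, one of them augmented by the parity of the literals gated to `q`). -/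
theorem exists_terminal_side (hI : I.IsPure xorAndPred) (hT : Typed I) (hS : SimpleOverlap I) (hB : BoundaryExpanding r I)
    (ht : Terminal I r y K w₁ w₂) {A B : Finset (Fin m)} (hAB : A ∪ B = K) (hA : A.Nonempty) (hBn : B.Nonempty)
    (P : Finset (Fin n)) (hAP : ∀ j ∈ A, ∀ s : Fin 4, I.vars j s ∈ P) (hBP : ∀ j ∈ B, ∀ s : Fin 4, I.vars j s ∉ P)
    {q : Fin n} (hq : q ∉ P)
    (hsw : ∀ g ∈ w₁.2.1 ∪ w₂.2.1, (I.vars g 2 ∈ P ↔ I.vars g 3 ∈ P) ∨ (I.vars g 2 ∈ P ∧ I.vars g 3 = q) ∨ (I.vars g 3 ∈ P ∧ I.vars g 2 = q)) :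
    ∃ d₁ d₂ : Finset (Fin n) × Finset (Fin m) × Bool,
      d₁.2.1 = gin I P w₁.2.1 ∧ d₂.2.1 = gin I P w₂.2.1 ∧ d₁.1 ⊆ P ∧ d₂.1 ⊆ P ∧ Terminal I r y A d₁ d₂ := by
  classical
  obtain ⟨-, hX, hKr, hd₁, hd₂, hr, hT3, hM0⟩ := ht
  have hAK : A ⊆ K := by rw [← hAB]; exact subset_union_left
  have hBK : B ⊆ K := by rw [← hAB]; exact subset_union_right
  have hAr : A.card ≤ r := (card_le_card hAK).trans hKr.le
  have hBr : B.card ≤ r := (card_le_card hBK).trans hKr.le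
  have hd : Disjoint K (w₁.2.1 ∪ w₂.2.1) := disjoint_union_right.2 ⟨hd₁, hd₂⟩
  have hAB' : ∀ j ∈ A, j ∉ B := fun j hjA hjB => hBP j hjB 0 (hAP j hjA 0)
  have hsw₁ : ∀ g ∈ w₁.2.1, (I.vars g 2 ∈ P ↔ I.vars g 3 ∈ P) ∨ (I.vars g 2 ∈ P ∧ I.vars g 3 = q) ∨ (I.vars g 3 ∈ P ∧ I.vars g 2 = q) :=
    fun g hg => hsw g (mem_union_left _ hg)
  have hsw₂ : ∀ g ∈ w₂.2.1, (I.vars g 2 ∈ P ↔ I.vars g 3 ∈ P) ∨ (I.vars g 2 ∈ P ∧ I.vars g 3 = q) ∨ (I.vars g 3 ∈ P ∧ I.vars g 2 = q) :=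
    fun g hg => hsw g (mem_union_right _ hg)
  -- the parts of the readers
  set F₁C := w₁.1.filter (· ∈ P) with hF₁C
  set F₂C := w₂.1.filter (· ∈ P) with hF₂C
  set Q₁C := w₁.1.filter (· ∉ P) with hQ₁C
  set Q₂C := w₂.1.filter (· ∉ P) with hQ₂C
  set F₁G := gin I P w₁.2.1 with hF₁G
  set F₂G := gin I P w₂.2.1 with hF₂G
  set Q₁G := gout I P w₁.2.1 with hQ₁G
  set Q₂G := gout I P w₂.2.1 with hQ₂G
  set L₁ := litSet I P w₁.2.1 with hL₁
  set L₂ := litSet I P w₂.2.1 with hL₂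
  set f₁ : Bool → (Fin n → Bool) → Bool := fun κ z => xor (gval I F₁C F₁G z) (κ && parity L₁ z) with hf₁
  set f₂ : Bool → (Fin n → Bool) → Bool := fun κ z => xor (gval I F₂C F₂G z) (κ && parity L₂ z) with hf₂
  set q₁ : (Fin n → Bool) → Bool := fun z => gval I Q₁C Q₁G z with hq₁
  set q₂ : (Fin n → Bool) → Bool := fun z => gval I Q₂C Q₂G z with hq₂
  have split₁ : ∀ z, gval I w₁.1 w₁.2.1 z = xor (f₁ (z q) z) (q₁ z) := fun z => by
    rw [gval_split_switch I P hq w₁.1 hsw₁ z]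
    exact bool_xor_right_comm _ _ _
  have split₂ : ∀ z, gval I w₂.1 w₂.2.1 z = xor (f₂ (z q) z) (q₂ z) := fun z => by
    rw [gval_split_switch I P hq w₂.1 hsw₂ z]
    exact bool_xor_right_comm _ _ _
  -- the class readers as G-constraints on `P`, over `A`
  set D₁ : Bool → Finset (Fin n) × Finset (Fin m) := fun κ => (F₁C ∆ (if κ then L₁ else ∅), F₁G) with hD₁
  set D₂ : Bool → Finset (Fin n) × Finset (Fin m) := fun κ => (F₂C ∆ (if κ then L₂ else ∅), F₂G) with hD₂
  have gD₁ : ∀ κ z, gval I (D₁ κ).1 (D₁ κ).2 z = f₁ κ z := fun κ z => gval_class I P w₁.1 w₁.2.1 κ z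
  have gD₂ : ∀ κ z, gval I (D₂ κ).1 (D₂ κ).2 z = f₂ κ z := fun κ z => gval_class I P w₂.1 w₂.2.1 κ z
  have gD₁₂ : ∀ κ z, gval I ((D₁ κ).1 ∆ (D₂ κ).1) ((D₁ κ).2 ∆ (D₂ κ).2) z = xor (f₁ κ z) (f₂ κ z) := fun κ z => by
    rw [gval_symmDiff, gD₁, gD₂]
  have sF₁G : F₁G ⊆ w₁.2.1 ∪ w₂.2.1 := (gin_subset I P _).trans subset_union_left
  have sF₂G : F₂G ⊆ w₁.2.1 ∪ w₂.2.1 := (gin_subset I P _).trans subset_union_right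
  have sQ₁G : Q₁G ⊆ w₁.2.1 ∪ w₂.2.1 := (gout_subset I P _).trans subset_union_left
  have sQ₂G : Q₂G ⊆ w₁.2.1 ∪ w₂.2.1 := (gout_subset I P _).trans subset_union_right
  have dA : ∀ {G : Finset (Fin m)}, G ⊆ w₁.2.1 ∪ w₂.2.1 → Disjoint A G := fun hG => (hd.mono_left hAK).mono_right hG
  have dB : ∀ {G : Finset (Fin m)}, G ⊆ w₁.2.1 ∪ w₂.2.1 → Disjoint B G := fun hG => (hd.mono_left hBK).mono_right hG
  have dA₁ : ∀ κ, Disjoint A (D₁ κ).2 := fun κ => dA sF₁G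
  have dA₂ : ∀ κ, Disjoint A (D₂ κ).2 := fun κ => dA sF₂G
  have dA₁₂ : ∀ κ, Disjoint A ((D₁ κ).2 ∆ (D₂ κ).2) := fun κ =>
    dA ((symmDiff_subset_union' F₁G F₂G).trans (union_subset sF₁G sF₂G))
  -- gluing along `P`
  have glueA : ∀ z z', (∀ j ∈ A, I.eval z j = y j) → ∀ j ∈ A, I.eval (P.piecewise z z') j = y j := by
    intro z z' hz j hj
    rw [eval_congr I hI (z' := z) fun s => Finset.piecewise_eq_of_mem _ _ _ (hAP j hj s)]
    exact hz j hj
  have glueB : ∀ z z', (∀ j ∈ B, I.eval z' j = y j) → ∀ j ∈ B, I.eval (P.piecewise z z') j = y j := by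
    intro z z' hz' j hj
    rw [eval_congr I hI (z' := z') fun s => Finset.piecewise_eq_of_notMem _ _ _ (hBP j hj s)]
    exact hz' j hj
  have glueIn : ∀ (C : Finset (Fin n)) (G : Finset (Fin m)) (z z' : Fin n → Bool),
      gval I (C.filter (· ∈ P)) (gin I P G) (P.piecewise z z') = gval I (C.filter (· ∈ P)) (gin I P G) z := by
    intro C G z z'
    refine gval_congr I (fun v hv => Finset.piecewise_eq_of_mem _ _ _ (mem_filter.1 hv).2) fun g hg => ?_
    obtain ⟨-, h2, h3⟩ := mem_filter.1 hg
    exact ⟨Finset.piecewise_eq_of_mem _ _ _ h2, Finset.piecewise_eq_of_mem _ _ _ h3⟩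
  have glueOut : ∀ (C : Finset (Fin n)) (G : Finset (Fin m)) (z z' : Fin n → Bool),
      gval I (C.filter (· ∉ P)) (gout I P G) (P.piecewise z z') = gval I (C.filter (· ∉ P)) (gout I P G) z' := by
    intro C G z z'
    refine gval_congr I (fun v hv => Finset.piecewise_eq_of_notMem _ _ _ (mem_filter.1 hv).2) fun g hg => ?_
    obtain ⟨-, h2, h3⟩ := mem_filter.1 hg
    exact ⟨Finset.piecewise_eq_of_notMem _ _ _ h2, Finset.piecewise_eq_of_notMem _ _ _ h3⟩
  have gluePar : ∀ (L : Finset (Fin n)), L ⊆ P → ∀ z z' : Fin n → Bool, parity L (P.piecewise z z') = parity L z := by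
    intro L hL z z'
    rw [← gval_empty I L, ← gval_empty I L]
    exact gval_congr I (fun v hv => Finset.piecewise_eq_of_mem _ _ _ (hL hv)) fun g hg => absurd hg (notMem_empty g)
  have glueF₁ : ∀ κ z z', f₁ κ (P.piecewise z z') = f₁ κ z := fun κ z z' => by
    change xor (gval I F₁C F₁G (P.piecewise z z')) (κ && parity L₁ (P.piecewise z z')) = xor (gval I F₁C F₁G z) (κ && parity L₁ z)
    rw [hF₁C, hF₁G, glueIn, hL₁, gluePar _ (litSet_subset I P _)]
  have glueF₂ : ∀ κ z z', f₂ κ (P.piecewise z z') = f₂ κ z := fun κ z z' => by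
    change xor (gval I F₂C F₂G (P.piecewise z z')) (κ && parity L₂ (P.piecewise z z')) = xor (gval I F₂C F₂G z) (κ && parity L₂ z)
    rw [hF₂C, hF₂G, glueIn, hL₂, gluePar _ (litSet_subset I P _)]
  have glueQ₁ : ∀ z z', q₁ (P.piecewise z z') = q₁ z' := fun z z' => by
    change gval I Q₁C Q₁G (P.piecewise z z') = gval I Q₁C Q₁G z'
    rw [hQ₁C, hQ₁G, glueOut]
  have glueQ₂ : ∀ z z', q₂ (P.piecewise z z') = q₂ z' := fun z z' => by
    change gval I Q₂C Q₂G (P.piecewise z z') = gval I Q₂C Q₂G z'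
    rw [hQ₂C, hQ₂G, glueOut]
  -- (T): a solution of `A` and a solution of `B` never complete each other, the switch read from the `B`-side
  have T : ∀ zA zB : Fin n → Bool, (∀ j ∈ A, I.eval zA j = y j) → (∀ j ∈ B, I.eval zB j = y j) →
      ¬ (xor (f₁ (zB q) zA) (q₁ zB) = w₁.2.2 ∧ xor (f₂ (zB q) zA) (q₂ zB) = w₂.2.2) := by
    rintro zA zB hzA hzB ⟨h₁, h₂⟩
    have hq' : P.piecewise zA zB q = zB q := Finset.piecewise_eq_of_notMem _ _ _ hq
    refine hT3 ⟨P.piecewise zA zB, fun j hj => ?_, ?_, ?_⟩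
    · rw [← hAB, mem_union] at hj
      rcases hj with hj | hj
      · exact glueA zA zB hzA j hj
      · exact glueB zA zB hzB j hj
    · rw [split₁, hq', glueF₁, glueQ₁]; exact h₁
    · rw [split₂, hq', glueF₂, glueQ₂]; exact h₂
  -- no solution of `A` matches an on-target solution of `B` in its own class
  have nohit : ∀ zw : Fin n → Bool, (∀ j ∈ B, I.eval zw j = y j) →
      xor (f₁ (zw q) zw) (q₁ zw) = w₁.2.2 → xor (f₂ (zw q) zw) (q₂ zw) = w₂.2.2 →
      ∀ z, (∀ j ∈ A, I.eval z j = y j) → ¬ (f₁ (zw q) z = f₁ (zw q) zw ∧ f₂ (zw q) z = f₂ (zw q) zw) := by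
    rintro zw hzw h₁ h₂ z hz ⟨e₁, e₂⟩
    exact T z zw hz hzw ⟨by rw [e₁]; exact h₁, by rw [e₂]; exact h₂⟩
  -- CLASS PINNING: on the switch class of an on-target solution `zw` of `B`, the `Pᶜ`-part is pinned on `Sol(B)` to its value at `zw`
  have classPin : ∀ zw : Fin n → Bool, (∀ j ∈ B, I.eval zw j = y j) →
      xor (f₁ (zw q) zw) (q₁ zw) = w₁.2.2 → xor (f₂ (zw q) zw) (q₂ zw) = w₂.2.2 →
      ∀ zB, (∀ j ∈ B, I.eval zB j = y j) → zB q = zw q → q₁ zB = q₁ zw ∧ q₂ zB = q₂ zw := by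
    intro zw hzw h₁ h₂ zB hzB hcl
    have nm := nohit zw hzw h₁ h₂
    set κ := zw q with hκ
    set v₁ := f₁ κ zw with hv₁
    set v₂ := f₂ κ zw with hv₂
    -- Lemma S over `A`, three times
    have S₁ : ∃ z, (∀ j ∈ A, I.eval z j = y j) ∧ f₁ κ z = v₁ := by
      by_contra h
      push Not at h
      exact gval_ne_of_ne_on_sol I hI hT hS hB y hAr (dA₁ κ) (c := v₁) (fun z hz => by rw [gD₁]; exact h z hz) zw
        (by rw [gD₁])
    have S₂ : ∃ z, (∀ j ∈ A, I.eval z j = y j) ∧ f₂ κ z = v₂ := by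
      by_contra h
      push Not at h
      exact gval_ne_of_ne_on_sol I hI hT hS hB y hAr (dA₂ κ) (c := v₂) (fun z hz => by rw [gD₂]; exact h z hz) zw
        (by rw [gD₂])
    have S₃ : ∃ z, (∀ j ∈ A, I.eval z j = y j) ∧ xor (f₁ κ z) (f₂ κ z) = xor v₁ v₂ := by
      by_contra h
      push Not at h
      exact gval_ne_of_ne_on_sol I hI hT hS hB y hAr (dA₁₂ κ) (c := xor v₁ v₂) (fun z hz => by rw [gD₁₂]; exact h z hz) zw
        (by rw [gD₁₂])
    obtain ⟨z₁, hz₁, e₁⟩ := S₁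
    obtain ⟨z₂, hz₂, e₂⟩ := S₂
    obtain ⟨z₃, hz₃, e₃⟩ := S₃
    have g₁ : f₂ κ z₁ = !v₂ := bool_snd_of_nand _ _ _ _ (nm z₁ hz₁) e₁
    have g₂ : f₁ κ z₂ = !v₁ := bool_fst_of_nand _ _ _ _ (nm z₂ hz₂) e₂
    have g₃ : f₁ κ z₃ = !v₁ ∧ f₂ κ z₃ = !v₂ := bool_both_of_nand _ _ _ _ (nm z₃ hz₃) e₃
    have hw₁ : q₁ zw = xor w₁.2.2 v₁ := bool_solve_xor _ _ _ h₁
    have hw₂ : q₂ zw = xor w₂.2.2 v₂ := bool_solve_xor _ _ _ h₂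
    rw [hw₁, hw₂]
    refine pin_of_three (q₁ zB) (q₂ zB) v₁ v₂ w₁.2.2 w₂.2.2 ?_ ?_ ?_
    · have := T z₁ zB hz₁ hzB; rwa [hcl, e₁, g₁] at this
    · have := T z₂ zB hz₂ hzB; rwa [hcl, g₂, e₂] at this
    · have := T z₃ zB hz₃ hzB; rwa [hcl, g₃.1, g₃.2] at this
  -- the (M0) witness of a member of `A`: a solution of `B`, on target; its class `κ₀` and values `c`
  obtain ⟨a₀, ha₀⟩ := hA
  obtain ⟨z₀, hz₀', hz₀₁, hz₀₂⟩ := hM0 a₀ (hAK ha₀)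
  have hz₀B : ∀ j ∈ B, I.eval z₀ j = y j := fun j hj => hz₀' j (mem_erase.2 ⟨fun h => hAB' a₀ ha₀ (by rw [← h]; exact hj), hBK hj⟩)
  rw [split₁] at hz₀₁
  rw [split₂] at hz₀₂
  set κ₀ := z₀ q with hκ₀
  set c₁ := f₁ κ₀ z₀ with hc₁
  set c₂ := f₂ κ₀ z₀ with hc₂
  -- the terminal core on `A`
  refine ⟨((D₁ κ₀).1, (D₁ κ₀).2, c₁), ((D₂ κ₀).1, (D₂ κ₀).2, c₂), rfl, rfl, ?_, ?_, ⟨a₀, ha₀⟩, xorClosed_side hX hAB P hAP hBP,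
    lt_of_le_of_lt (card_le_card hAK) hKr, dA₁ κ₀, dA₂ κ₀, ?_, ?_, ?_⟩
  · change F₁C ∆ (if κ₀ then L₁ else ∅) ⊆ P
    refine (symmDiff_subset_union' _ _).trans (union_subset (fun v hv => (mem_filter.1 hv).2) ?_)
    cases κ₀
    · simp
    · rw [if_pos rfl]; exact litSet_subset I P _
  · change F₂C ∆ (if κ₀ then L₂ else ∅) ⊆ P
    refine (symmDiff_subset_union' _ _).trans (union_subset (fun v hv => (mem_filter.1 hv).2) ?_)
    cases κ₀
    · simp
    · rw [if_pos rfl]; exact litSet_subset I P _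
  · -- `#(A ∪ D₁ ∪ D₂) ≤ r`
    refine le_trans (card_le_card ?_) hr
    exact union_subset_union (union_subset_union hAK (gin_subset I P _)) (gin_subset I P _)
  · -- (T3) for `A`
    rintro ⟨z, hzA, h₁, h₂⟩
    change gval I (D₁ κ₀).1 (D₁ κ₀).2 z = c₁ at h₁
    change gval I (D₂ κ₀).1 (D₂ κ₀).2 z = c₂ at h₂
    rw [gD₁] at h₁
    rw [gD₂] at h₂
    exact nohit z₀ hz₀B hz₀₁ hz₀₂ z hzA ⟨h₁, h₂⟩
  · -- (M0) for `A`: every witness lies in the class `κ₀`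
    intro e he
    obtain ⟨zₑ, hzₑ', hzₑ₁, hzₑ₂⟩ := hM0 e (hAK he)
    have hzₑB : ∀ j ∈ B, I.eval zₑ j = y j :=
      fun j hj => hzₑ' j (mem_erase.2 ⟨fun h => hAB' e he (by rw [← h]; exact hj), hBK hj⟩)
    have hzₑA : ∀ j ∈ A.erase e, I.eval zₑ j = y j :=
      fun j hj => hzₑ' j (mem_erase.2 ⟨ne_of_mem_erase hj, hAK (mem_of_mem_erase hj)⟩)
    rw [split₁] at hzₑ₁
    rw [split₂] at hzₑ₂
    by_cases hcl : zₑ q = κ₀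
    · -- same class: the pinned `Pᶜ`-part puts the witness on target for `(A; D κ₀)`
      obtain ⟨p₁, p₂⟩ := classPin z₀ hz₀B hz₀₁ hz₀₂ zₑ hzₑB hcl
      rw [hcl, p₁] at hzₑ₁
      rw [hcl, p₂] at hzₑ₂
      refine ⟨zₑ, hzₑA, ?_, ?_⟩
      · change gval I (D₁ κ₀).1 (D₁ κ₀).2 zₑ = c₁
        rw [gD₁]
        exact bool_eq_of_xor_eq _ _ _ _ hzₑ₁ hz₀₁
      · change gval I (D₂ κ₀).1 (D₂ κ₀).2 zₑ = c₂
        rw [gD₂]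
        exact bool_eq_of_xor_eq _ _ _ _ hzₑ₂ hz₀₂
    · -- both classes met: the `Pᶜ`-part with the switch added linearly is pinned on `Sol(B)`, hence everywhere — against a witness of `B`
      exfalso
      have hcl' : zₑ q = !κ₀ := bool_eq_not_of_ne _ _ hcl
      set δ₁ := xor (q₁ z₀) (q₁ zₑ) with hδ₁
      set δ₂ := xor (q₂ z₀) (q₂ zₑ) with hδ₂
      set t₁ := xor (q₁ z₀) (δ₁ && κ₀) with ht₁
      set t₂ := xor (q₂ z₀) (δ₂ && κ₀) with ht₂
      set Γ₁ : Finset (Fin n) × Finset (Fin m) := (Q₁C ∆ (if δ₁ then ({q} : Finset (Fin n)) else ∅), Q₁G) with hΓ₁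
      set Γ₂ : Finset (Fin n) × Finset (Fin m) := (Q₂C ∆ (if δ₂ then ({q} : Finset (Fin n)) else ∅), Q₂G) with hΓ₂
      have gΓ₁ : ∀ z, gval I Γ₁.1 Γ₁.2 z = xor (q₁ z) (δ₁ && z q) := fun z => gval_out_switch I P w₁.1 w₁.2.1 q δ₁ z
      have gΓ₂ : ∀ z, gval I Γ₂.1 Γ₂.2 z = xor (q₂ z) (δ₂ && z q) := fun z => gval_out_switch I P w₂.1 w₂.2.1 q δ₂ z
      -- the value of the `Pᶜ`-part with the switch added is the same constant on both classes of `Sol(B)`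
      have pinB : ∀ zB, (∀ j ∈ B, I.eval zB j = y j) → xor (q₁ zB) (δ₁ && zB q) = t₁ ∧ xor (q₂ zB) (δ₂ && zB q) = t₂ := by
        intro zB hzB
        by_cases hc : zB q = κ₀
        · obtain ⟨p₁, p₂⟩ := classPin z₀ hz₀B hz₀₁ hz₀₂ zB hzB hc
          rw [p₁, p₂, hc]
          exact ⟨rfl, rfl⟩
        · have hc' : zB q = !κ₀ := bool_eq_not_of_ne _ _ hc
          obtain ⟨p₁, p₂⟩ := classPin zₑ hzₑB hzₑ₁ hzₑ₂ zB hzB (by rw [hc', hcl'])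
          rw [p₁, p₂, hc']
          exact ⟨bool_switch_id _ _ _, bool_switch_id _ _ _⟩
      have dΓ₁ : Disjoint B Γ₁.2 := dB sQ₁G
      have dΓ₂ : Disjoint B Γ₂.2 := dB sQ₂G
      have ev₁ : ∀ z, xor (q₁ z) (δ₁ && z q) = t₁ := by
        intro z
        have h := gval_ne_of_ne_on_sol I hI hT hS hB y hBr dΓ₁ (c := !t₁)
          (fun zB hzB => by rw [gΓ₁, (pinB zB hzB).1]; exact bool_ne_not_self _) z
        rw [gΓ₁] at h
        exact bool_eq_of_ne_not _ _ h
      have ev₂ : ∀ z, xor (q₂ z) (δ₂ && z q) = t₂ := by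
        intro z
        have h := gval_ne_of_ne_on_sol I hI hT hS hB y hBr dΓ₂ (c := !t₂)
          (fun zB hzB => by rw [gΓ₂, (pinB zB hzB).2]; exact bool_ne_not_self _) z
        rw [gΓ₂] at h
        exact bool_eq_of_ne_not _ _ h
      -- a witness of a member of `B`: a solution of `A`, on target
      obtain ⟨b₀, hb₀⟩ := hBn
      obtain ⟨z', hz'', hz'₁, hz'₂⟩ := hM0 b₀ (hBK hb₀)
      have hz'A : ∀ j ∈ A, I.eval z' j = y j :=
        fun j hj => hz'' j (mem_erase.2 ⟨fun h => hAB' j hj (by rw [h]; exact hb₀), hAK hj⟩)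
      rw [split₁] at hz'₁
      rw [split₂] at hz'₂
      have e₁ := ev₁ z'
      have e₂ := ev₂ z'
      by_cases hc : z' q = κ₀
      · -- `z'` in the class of `z₀`: its `Pᶜ`-part equals that of `z₀`, so its `P`-part hits `c`
        rw [hc] at hz'₁ hz'₂ e₁ e₂
        have u₁ : q₁ z' = q₁ z₀ := bool_cancel_xor _ _ _ e₁
        have u₂ : q₂ z' = q₂ z₀ := bool_cancel_xor _ _ _ e₂
        rw [u₁] at hz'₁
        rw [u₂] at hz'₂
        exact nohit z₀ hz₀B hz₀₁ hz₀₂ z' hz'A ⟨bool_eq_of_xor_eq _ _ _ _ hz'₁ hz₀₁, bool_eq_of_xor_eq _ _ _ _ hz'₂ hz₀₂⟩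
      · -- `z'` in the class of `zₑ`
        have hc' : z' q = !κ₀ := bool_eq_not_of_ne _ _ hc
        have hcc : z' q = zₑ q := by rw [hc', hcl']
        rw [hc'] at e₁ e₂
        have u₁ : q₁ z' = q₁ zₑ := bool_switch_cancel _ _ _ _ e₁
        have u₂ : q₂ z' = q₂ zₑ := bool_switch_cancel _ _ _ _ e₂
        rw [hcc, u₁] at hz'₁
        rw [hcc, u₂] at hz'₂
        exact nohit zₑ hzₑB hzₑ₁ hzₑ₂ z' hz'A ⟨bool_eq_of_xor_eq _ _ _ _ hz'₁ hzₑ₁, bool_eq_of_xor_eq _ _ _ _ hz'₂ hzₑ₂⟩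

/-! ## Inside the core-bound induction: both sides small, no centre -/

/-- **A SINGLE CROSS MONOMIAL: both sides are terminal cores, so `#K ≤ 10` inside the induction.**  If every straddling monomial has its
outside variable `q` AND its inside variable `p` (e.g. one cross gadget / gate `(p, q)`, possibly in both readers), and every terminal core on a
proper subset of `K` has at most five members, then `#K ≤ 10`. -/
theorem card_le_ten_of_switch (hI : I.IsPure xorAndPred) (hT : Typed I) (hS : SimpleOverlap I) (hB : BoundaryExpanding r I)
    (ht : Terminal I r y K w₁ w₂) {A B : Finset (Fin m)} (hAB : A ∪ B = K) (hA : A.Nonempty) (hBn : B.Nonempty)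
    (P : Finset (Fin n)) (hAP : ∀ j ∈ A, ∀ s : Fin 4, I.vars j s ∈ P) (hBP : ∀ j ∈ B, ∀ s : Fin 4, I.vars j s ∉ P)
    {p q : Fin n} (hp : p ∈ P) (hq : q ∉ P)
    (hsw : ∀ g ∈ w₁.2.1 ∪ w₂.2.1, (I.vars g 2 ∈ P ↔ I.vars g 3 ∈ P) ∨ (I.vars g 2 ∈ P ∧ I.vars g 3 = q) ∨ (I.vars g 3 ∈ P ∧ I.vars g 2 = q))
    (hsw' : ∀ g ∈ w₁.2.1 ∪ w₂.2.1, (I.vars g 2 ∈ P ↔ I.vars g 3 ∈ P) ∨ (I.vars g 2 ∉ P ∧ I.vars g 3 = p) ∨ (I.vars g 3 ∉ P ∧ I.vars g 2 = p))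
    (hIH : ∀ c ∈ K, ∀ K₀ ⊆ K.erase c, ∀ d₁ d₂ : Finset (Fin n) × Finset (Fin m) × Bool, Terminal I r y K₀ d₁ d₂ → K₀.card ≤ 5) :
    K.card ≤ 10 := by
  classical
  have hAK : A ⊆ K := by rw [← hAB]; exact subset_union_left
  have hBK : B ⊆ K := by rw [← hAB]; exact subset_union_right
  have hAB' : ∀ j ∈ A, j ∉ B := fun j hjA hjB => hBP j hjB 0 (hAP j hjA 0)
  obtain ⟨a₀, ha₀⟩ := hA
  obtain ⟨b₀, hb₀⟩ := hBn
  -- the side `A`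
  obtain ⟨d₁, d₂, -, -, -, -, htA⟩ := exists_terminal_side hI hT hS hB ht hAB ⟨a₀, ha₀⟩ ⟨b₀, hb₀⟩ P hAP hBP hq hsw
  have hA5 : A.card ≤ 5 :=
    hIH b₀ (hBK hb₀) A (fun j hj => mem_erase.2 ⟨fun h => hAB' j hj (h ▸ hb₀), hAK hj⟩) d₁ d₂ htA
  -- the side `B`, through the complementary variable set
  have hsw'' : ∀ g ∈ w₁.2.1 ∪ w₂.2.1, (I.vars g 2 ∈ Pᶜ ↔ I.vars g 3 ∈ Pᶜ) ∨ (I.vars g 2 ∈ Pᶜ ∧ I.vars g 3 = p) ∨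
      (I.vars g 3 ∈ Pᶜ ∧ I.vars g 2 = p) := by
    intro g hg
    simp only [mem_compl]
    rcases hsw' g hg with h | h | h
    · exact Or.inl (not_congr h)
    · exact Or.inr (Or.inl h)
    · exact Or.inr (Or.inr h)
  obtain ⟨d₁', d₂', -, -, -, -, htB⟩ := exists_terminal_side hI hT hS hB ht (A := B) (B := A) (by rw [union_comm, hAB]) ⟨b₀, hb₀⟩
    ⟨a₀, ha₀⟩ Pᶜ (fun j hj s => mem_compl.2 (hBP j hj s)) (fun j hj s => fun h => (mem_compl.1 h) (hAP j hj s))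
    (q := p) (fun h => (mem_compl.1 h) hp) hsw''
  have hB5 : B.card ≤ 5 :=
    hIH a₀ (hAK ha₀) B (fun j hj => mem_erase.2 ⟨fun h => hAB' a₀ ha₀ (h ▸ hj), hBK hj⟩) d₁' d₂' htB
  have hdisj : Disjoint A B := disjoint_left.2 hAB'
  rw [← hAB, card_union_of_disjoint hdisj]
  omega

/-- **NO CENTRE across a single cross monomial** (inside the induction): an XOR-disconnected terminal core coupled through one cross monomial has
no non-empty leafless set of non-chords — such a set forces `12 ≤ 2·#sharedSlots ≤ #K` (`twelve_le_two_mul_card_sharedSlots`,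
`two_mul_card_sharedSlots_le`), against `#K ≤ 10`.  The census of centre structures may therefore discard these splittings. -/
theorem no_centre_of_switch (hI : I.IsPure xorAndPred) (hT : Typed I) (hS : SimpleOverlap I) (hB : BoundaryExpanding r I)
    (ht : Terminal I r y K w₁ w₂) {A B : Finset (Fin m)} (hAB : A ∪ B = K) (hA : A.Nonempty) (hBn : B.Nonempty)
    (P : Finset (Fin n)) (hAP : ∀ j ∈ A, ∀ s : Fin 4, I.vars j s ∈ P) (hBP : ∀ j ∈ B, ∀ s : Fin 4, I.vars j s ∉ P)
    {p q : Fin n} (hp : p ∈ P) (hq : q ∉ P)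
    (hsw : ∀ g ∈ w₁.2.1 ∪ w₂.2.1, (I.vars g 2 ∈ P ↔ I.vars g 3 ∈ P) ∨ (I.vars g 2 ∈ P ∧ I.vars g 3 = q) ∨ (I.vars g 3 ∈ P ∧ I.vars g 2 = q))
    (hsw' : ∀ g ∈ w₁.2.1 ∪ w₂.2.1, (I.vars g 2 ∈ P ↔ I.vars g 3 ∈ P) ∨ (I.vars g 2 ∉ P ∧ I.vars g 3 = p) ∨ (I.vars g 3 ∉ P ∧ I.vars g 2 = p))
    (hIH : ∀ c ∈ K, ∀ K₀ ⊆ K.erase c, ∀ d₁ d₂ : Finset (Fin n) × Finset (Fin m) × Bool, Terminal I r y K₀ d₁ d₂ → K₀.card ≤ 5) :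
    ¬ ∃ S ⊆ K, S.Nonempty ∧ (∀ w ∈ xverts I S, 2 ≤ xpdeg I S w) ∧ ∀ f ∈ S, ¬ IsChord I K f := by
  rintro ⟨S, hSK, hne, hL, hnc⟩
  have h10 := card_le_ten_of_switch hI hT hS hB ht hAB hA hBn P hAP hBP hp hq hsw hsw' hIH
  have h12 := twelve_le_two_mul_card_sharedSlots I hI hT hS hB ht.2.2.1.le hSK hne hL hnc
  have h2 := two_mul_card_sharedSlots_le I K ht.2.1 (hB K ht.2.2.1.le)
  omega

end Summit.PneNP.PneNP.Theorems.PstarSwitchSplit
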